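import Summits.QuantumFields.YangMills.Theses.ToronSmallBall
import Summits.QuantumFields.YangMills.Theorems.ToronSmallBallOwnAxisShiftWindow
import Summits.QuantumFields.YangMills.Theorems.ToronSmallBallOwnAxisShiftNumerics
import HarnessLib

/-!
# `ToronSmallBall.PeriodicOffCoreStripWindowDeep` (item stmt-QuantumFields-24089) — PROVED

Route `ToronSmallBall` rev 4 (D-0145 LINE g12-A of seat ym-idea-4), crux ⟨24089⟩: the PERIODIC-SECTOR half of the deep off-core strip window.  For every
hand-over exponent `γc ≤ 2/5` there is `a₀ = 1/400` such that for every window exponent `0 < a ≤ a₀`, with `γ = 1/2 − 4a < 1/2 − 3a`, for `β ≥ β₀(a)`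
and every `1 ≤ L ≤ β^a`, the untwisted seam-sector weight of the slice-`0` event `{|polDist U − polDist(S U)| ≤ β^(−γ), β^(−γc) < polDist U}` on
the `2L`-ring is `≤ β^(−a) · Z_phys(2L)`.

METHOD (seat ym-dw-p1 g15, modules `Theorems/ToronSmallBallOwnAxisShift*`): the OWN-AXIS CLASS SHIFT.  Every `x`-line of every slice is rotated about
the axis of its OWN holonomy (`ownShift θ`): the holonomy classes move by exactly `θ` (`OwnAxis.polyX_ownShift`), the `y`-holonomy is untouched, and
the map is gauge covariant with no external axis field (`OwnAxis.ownShift_gaugeTransform`), so the untwisted seam is an ordinary bond.  Off the core all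
line holonomies of all slices are non-central by a floor `σ = β^(−2/5)/4` (propagation on the good-field event, `…Good`), hence (i) the one-line Jacobian
of the tree's `ClassShift.lintegral_indicator_update_classShift_le` iterates to `((1 − θ/σ)⁻²)^{#plane·2L} ≤ 2` (`…Jacobian`, `…Translate`), and
(ii) the action/coupling change is SECOND ORDER in the axis defect `≲ θ · (ladder of plaquettes)/σ` (`…Local`, `…Ladder`, `…Cost`), `≤ 1` in the
exponent on the window.  `K = ⌈64eβ^a⌉` angular translates by multiples of `6β^(−γ)` have pairwise disjoint images (strip separation, `…Angle`,
`…Domination`), so the strip carries `≤ 2·2e/K` of the periodic sector plus the bad fields (`…Counting`, `…Window`); the numeric inequalities hold for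
`β ≥ β₀(a)` (`…Numerics`).  The core exponent enters only through `{β^(−γc) < polDist} ⊆ {β^(−2/5) < polDist}`.

HONEST FRAMING: one crux of a DRAFT-by-design line (route `ToronSmallBall` → `SwapTwistDeficit.TwistDeficitLaplaceWindow`); the electric-flux crux
`FluxSectorSuppression` ⟨24079⟩ and the core crux ⟨23956⟩ remain OPEN; fixed-lattice estimate, nothing about infinite volume or the continuum limit; the
Yang–Mills mass gap is NOT proved.  No `sorry`, no new axiom, no new definition.
References: [cite: Luscher1983, §2]; [cite: tHooft1979]; [cite: MontvayMunster1994, (3.145)]; [cite: MadrasSokal1988, §2].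
-/

set_option autoImplicit false

noncomputable section

open MeasureTheory Set Function
open Literature.MathematicalPhysics.QuantumFieldTheory hiding su2Quat_mul SU2
open Summit.QuantumFields.YangMills.Theorems.FemtoTransferGap
open Summit.QuantumFields.YangMills.Theorems.FemtoTransferGap.TT
open Summit.QuantumFields.YangMills.Theorems.FemtoTransferGap.FlatSheet

namespace Summit.QuantumFields.YangMills.Theorems.ToronSmallBall

set_option maxHeartbeats 800000 in
/-- ★ **`ToronSmallBall.PeriodicOffCoreStripWindowDeep` holds** (item stmt-QuantumFields-24089, BY NAME): the periodic-sector deep off-core strip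
window, by the own-axis class shift (`a₀ = 1/400`, `γ = 1/2 − 4a`, `L₀ = 1`).  No summit conjunct is touched; the Yang–Mills mass gap is NOT proved.
[cite: Luscher1983, §2] [cite: MontvayMunster1994, (3.145)] -/
theorem periodicOffCoreStripWindowDeep_proof : Summit.QuantumFields.YangMills.Theses.ToronSmallBall.PeriodicOffCoreStripWindowDeep := by
  intro γc hγc
  refine ⟨1 / 400, by norm_num, by norm_num, fun a ha ha' => ?_⟩
  obtain ⟨β₀, hβ₀⟩ := OwnAxis.numerics_of_le ha ha'
  refine ⟨1 / 2 - 4 * a, by linarith, β₀, 1, fun β hβ L _ hL hLβ => ?_⟩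
  obtain ⟨h200, hη, hw, hθ', hσ, hσ1, hfl, hK, hKσ, hQ, hJ, hG, hKa⟩ := hβ₀ β hβ L hL hLβ
  have hβ1 : 1 ≤ β := by linarith
  -- the core exponent: `{β^{-γc} < polDist} ⊆ {β^{-2/5} < polDist}`
  have hcore : β ^ (-(2 / 5 : ℝ)) ≤ β ^ (-γc) := Real.rpow_le_rpow_of_exponent_le hβ1 (by linarith)
  have hsub : {U : GaugeConfig 3 L SU2 | |polDist U - polDist (configPerm (Equiv.swap (0 : Fin 3) 1) U)| ≤ β ^ (-(1 / 2 - 4 * a)) ∧ β ^ (-γc) < polDist U} ⊆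
      {U : GaugeConfig 3 L SU2 | |polDist U - polDist (configPerm (Equiv.swap (0 : Fin 3) 1) U)| ≤ β ^ (-(1 / 2 - 4 * a)) ∧ β ^ (-(2 / 5 : ℝ)) < polDist U} :=
    fun U hU => ⟨hU.1, hcore.trans_lt hU.2⟩
  have hmono : sectorWeight β (2 * L - 1) (fun _ => false) (fun Us _ =>
        {U : GaugeConfig 3 L SU2 | |polDist U - polDist (configPerm (Equiv.swap (0 : Fin 3) 1) U)| ≤ β ^ (-(1 / 2 - 4 * a)) ∧ β ^ (-γc) < polDist U}.indicator
          (fun _ => (1 : ℝ)) (Us 0)) ≤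
      sectorWeight β (2 * L - 1) (fun _ => false) (fun Us _ =>
        {U : GaugeConfig 3 L SU2 | |polDist U - polDist (configPerm (Equiv.swap (0 : Fin 3) 1) U)| ≤ β ^ (-(1 / 2 - 4 * a)) ∧ β ^ (-(2 / 5 : ℝ)) < polDist U}.indicator
          (fun _ => (1 : ℝ)) (Us 0)) :=
    sectorWeight_mono β (2 * L - 1) (fun _ => false) (C := 1)
      (measurable_uncurry_slice_zero (measurable_const.indicator (OwnAxis.measurableSet_strip' (L := L) _ _)))
      (measurable_uncurry_slice_zero (measurable_const.indicator (OwnAxis.measurableSet_strip' (L := L) _ _)))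
      (fun Us _ => abs_indicator_one_le _ (Us 0)) (fun Us _ => abs_indicator_one_le _ (Us 0))
      (fun Us _ => Set.indicator_le_indicator_of_subset hsub (fun _ => zero_le_one) (Us 0))
  -- the window estimate with the frozen constants
  have hwin := OwnAxis.sectorWeight_strip_le_rpow_of_numerics (L := L) (a := a) (η := β ^ (-(19 / 40 : ℝ))) (w := β ^ (-(1 / 2 - 4 * a)))
    (c₀ := β ^ (-(2 / 5 : ℝ))) (σ := β ^ (-(2 / 5 : ℝ)) / 4) (θ' := 6 * β ^ (-(1 / 2 - 4 * a))) (K := ⌈64 * Real.exp 1 * β ^ a⌉₊)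
    h200 hη hw hθ' hσ hσ1 hfl hK hKσ hQ hJ hG hKa
  exact hmono.trans hwin

end Summit.QuantumFields.YangMills.Theorems.ToronSmallBall

end
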